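import Summits.ResolutionOfSingularities.ResolutionOfSingularities.Theorems.EquisingularLiftEquisingularLiftNatNosePointsFirstHSUB
import Summits.ResolutionOfSingularities.ResolutionOfSingularities.Theorems.EquisingularLiftEquisingularLiftNatSubchainPointResolutionOff
import Summits.ResolutionOfSingularities.ResolutionOfSingularities.Theorems.EquisingularLiftEquisingularLiftNatResidueHypDefs5
import Summits.ResolutionOfSingularities.ResolutionOfSingularities.Theorems.EquisingularLiftEquisingularLiftNatResidueHypDefs
import HarnessLib

/-!
# [OURS · L1 W4.5(b) · EL♮(3) · NOSE] THE POINTS-FIRST NOSE RUNG (R-ν2) — `stub_elnat_pointsFirstNoseTowerBTriplePrimeResolutionThree`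

res-L1-w45b-nose-w2 g0 (WIDTH seat, nose row; NOSE WORD v1, desk R33 (δ) / R35 / R36 (β)). OURS; NOT a statement of any manuscript ([Hironaka2017] is a candidate under
adjudication, nothing of it is asserted); AI-written, weaker than expert review. No `sorry`; standard axioms; DEF-FREE; `--supports stmt-ResolutionOfSingularities-20148 --as helper`.
Resolution of singularities in positive characteristic is NOT proved here or anywhere in this chain; EL♮(3) is NOT proved by this file.

WHAT. For `p` prime, `k` algebraically closed of characteristic `p`, `H ↪ ℙ³_k` an integral hypersurface-like closed subscheme (`HypLocPrincipal`), and MODULO the registered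
NEED-FACT (T-k) `EmbeddedCurveLiftFact` (as every rung since the 19th registration): the named hypothesis `NoseHypPointsFirstBTriplePrime k 3 H ι` (res-type-027
`…NatResidueHypDefs5`: an E1-legal POINT PREFIX, then the nose move `ReachPtNoseBTriplePrime` one floor up — unobstructed regular nose, its blow-up, a B‴ chain — reaching a
stage whose reduced strict transform is regular; K5′'s `hres` shape) implies the EL♮ conclusion `ELNatConclusionO k 3 H ι`. Three lines: K5′ `target_elnat_of_subchainResolution'`
(res-L1-w45b-lead-2) at `Reach := ReachPtNoseBTriplePrime`, its HSUB slot supplied by `hsub_reachPtNoseBTriplePrime_of_fact` (…NatNosePointsFirstHSUB) over (T-k).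
This is the closing theorem the NOSE CUT (desk R35/R36: new nose residue = the 35th's + `¬ NoseHypPointsFirstBTriplePrime k n H ι`) derives the old residue with.
-/

set_option linter.dupNamespace false -- mandated namespace `Summit.<Summit>.<Problem>` of this single-conjunct summit
set_option linter.overlappingInstances false -- signatures carry `[IsDomain O] [IsDiscreteValuationRing O]`

noncomputable section

open CategoryTheory CategoryTheory.Limits AlgebraicGeometry TopologicalSpace Topology IsLocalRing
open Literature.AlgebraicGeometry.Resolution
open AlgebraicGeometry.Scheme.IdealSheafData

namespace Summit.ResolutionOfSingularities.ResolutionOfSingularities.Cruxes.EquisingularLiftNat.Sections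

/-- **THE POINTS-FIRST NOSE RUNG (R-ν2) at n = 3, modulo (T-k)**: `EmbeddedCurveLiftFact → … → NoseHypPointsFirstBTriplePrime k 3 H ι → ELNatConclusionO k 3 H ι`.
K5′ ∘ `hsub_reachPtNoseBTriplePrime_of_fact` ∘ (T-k). [folklore composition of named tree theorems] [OURS · L1 W4.5b · nose (R-ν2)] -/
theorem stub_elnat_pointsFirstNoseTowerBTriplePrimeResolutionThree (p : ℕ) : EmbeddedCurveLiftFact → p.Prime →
    ∀ (k : Type) [Field k] [CharP k p] [IsAlgClosed k] (H : AlgebraicGeometry.Scheme.{0})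
    (ι : H ⟶ (Literature.AlgebraicGeometry.Motives.projectiveSpace 3 k).left),
    AlgebraicGeometry.IsClosedImmersion ι → AlgebraicGeometry.IsIntegral H →
    (∀ y : (Literature.AlgebraicGeometry.Motives.projectiveSpace 3 k).left,
      ∃ U : (Literature.AlgebraicGeometry.Motives.projectiveSpace 3 k).left.affineOpens,
        y ∈ (U : (Literature.AlgebraicGeometry.Motives.projectiveSpace 3 k).left.Opens) ∧ (ι.ker.ideal U).IsPrincipal) →
    NoseHypPointsFirstBTriplePrime k 3 H ι → ELNatConclusionO k 3 H ι := by
  intro hF hp k _ _ _ H ι hι hH hloc hres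
  exact target_elnat_of_subchainResolution' p hp k 3 H ι hι hH hloc ReachPtNoseBTriplePrime
    (fun O _ _ _ _ _ θ hθ P q => hsub_reachPtNoseBTriplePrime_of_fact k O θ hθ P q (hF k O θ hθ P q)) hres

end Summit.ResolutionOfSingularities.ResolutionOfSingularities.Cruxes.EquisingularLiftNat.Sections

end
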